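import Literature.MathematicalPhysics.QuantumFieldTheory.Balaban1983to89.B1Eq324BenfattoSect5Eq524
import HarnessLib

/-!
# `Balaban1983to89.B1Eq324BenfattoSect5Eq534` — [BenfattoEtAl1978] §5 p. 159, (5.33)–(5.34): the corridor Hamiltonians of the boxes
# RE-ASSEMBLE into `H_{Γ̄₁}`, `Γ̄₁ = ⋃_□[Γ₁(□)∪Γ₂(□)∪Γ₄(□)]`, up to exponentially small EXTENSIVE errors — PROVED for the tree's objects,
# together with the general «as usual [see (5.24)]» bound on the interaction of two separated regions and the a-priori size (5.15) i)

statement-level skeleton of published theorems with citation tags; proofs where landed; nothing here is a claim about the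
Yang–Mills mass gap

WHY THIS MODULE (cell `pub-ymgap`, seat `dag-n08-d` gen 9, INTENT-26; node N08 [Balaban1985UV3]; the [BenfattoEtAl1978] source chain behind
the (α)-row `h324c`: [B10] (24)/(58) ← [B1] (3.24) ← [BenfattoEtAl1978] Lemma p. 152 = `B1Eq324BenfattoLemma.BasicLemmaPrinted`; dag-lead
DEDUP-295: the STRUCTURAL estimates (5.11)/(5.24)/(5.27)/(5.34) on the corridor Hamiltonians are this seat's, the cumulant side is n08-b's —
(5.11)/(5.24)/(5.27) are `…Sect5Eq511`/`…Sect5Eq524`; this file is (5.34)).  Print, p. 159 (render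
`lit-balaban-typer/renders/benfatto1978-cmp59/bcg_p159_s3.png`, read first-hand): *"Each factor in the product sign can be reexpressed using the
cumulant formula backwards as ∫P̄(dz_□|z_{Γ₁})χ^b_□ exp(H_{Γ₂(□)∪Γ₄(□)} + H_{Γ₂(□),Γ₁(□)} − H_{Γ₄(□),Γ₂(□)∖Γ₃(□)})·exp{τ[…]} (5.33) where as
usual τ is a function with values in [−1, 1]. We now bound H_{Γ₄(□),Γ₂(□)∖Γ₃(□)} as usual [see (5.24)] use the Markov property of P̄ and
remark that if Γ̄₁ = ⋃_{□∈Q^b}[Γ₁(□)∪Γ₂(□)∪Γ₄(□)]  H_{Γ₁} + Σ_{□∈Q^b}(H_{Γ₂(□)∪Γ₄(□)} + H_{Γ₂(□),Γ₁(□)}) = H_{Γ̄₁} + τ|I|(s₁Ab^De^{−(ϰ/8)b^{3/2}})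
(5.34)"*.

DICTIONARY (print ↦ Lean; the objects of `…Sect5Boxes`/`…Sect5Eq524`: tesserae `box L m` of side `L` (print `b²`), corridors `frame1`/`frame2`
of width `w` (print `b^{3/2}`), core `□′ = core = shrink 2w`, inner corridors `frame3 ⊂ frame2`, `frame4 ⊂ □′` of width `v` (print `½b^{3/2}`),
`Γ₁ = corridors L w B` over a finite family `B` of tesserae, `H_R = hamiltonian`, `H_{R,S} = interaction`, `Ψ′₁ = psi1p`, `Ψ₂ = psi2`).
* `Γ̄₁` ↦ `corridorsBar L w v B := corridors L w B ∪ ⋃_{m∈B}(frame2 L w m ∪ frame4 L w v m)` (DEFINITION).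
* the three tuple classes (5.34) accounts for — inside `Γ₁`, inside some `Γ₂(□)∪Γ₄(□)`, crossing `Γ₂(□)`/`Γ₁(□)` (`Sect5Eq511.crossTuples`) — ↦
  `hatTuplesBar J p L w v B` (DEFINITION); `H_{Γ̄₁}` minus the left side of (5.34) is the sum over the REMAINDER `tuplesIn Γ̄₁ ∖ hatTuplesBar`.

WHAT IS PROVED (standard axioms; no `sorry`; hypotheses as in `Sect5Eq511.abs_Hl_le_of_range`: the extension convention `CoefSupportedIn a J`,
`|A^{n}_{Δ}| ≤ A` on the range of (4.5), `|z_Δ| ≤ b` on `J`, `b ≥ 1`, `L ≥ 1`).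
* §1 ★ `abs_classSum_le` — THE GENERIC ENGINE behind (5.11)/(5.24)/(5.34) (the common tail of `abs_Hl_le`/`abs_psi3_le`, factored once): a
  family of tuple classes all of whose members have `d(Δ) ≥ ρ` and all tesserae in a region `R` has
  `|Σ_{p≤s} Σ_{class} Σ_n A e^{−(ϰ/2)d(Δ)} Π z^{n}| ≤ s₁·A·b^D·e^{−(ϰ/4)ρ}·|R|`.
* §2 ★ `le_connLength_of_mem_crossT_of_sep`, ★★ `abs_interaction_le_of_sep` — EVERY «as usual [see (5.24)]» of pp. 157–159 in one statement:
  for DISJOINT regions `R`, `S` whose tesserae are pairwise `≥ ρ` apart, `|H_{R,S}(z)| ≤ s₁·A·b^D·e^{−(ϰ/4)ρ}·|R ∪ S|`.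
* §3 (5.34): `frame2_union_frame4_subset_shrink`, `mem_corridorsBar_box` (a site of `Γ̄₁` in `□_m`, `m ∈ B`, lies in `Γ₁(□)` or in
  `Γ₂(□)∪Γ₄(□)`), the disjointness of the classes, `hatTuplesBar_subset`, `sum_tuplesIn_corridorsBar_eq` (the tuple identity), ★
  `le_connLength_of_mem_remainderBar` — EVERY REMAINDER TUPLE HAS `d(Δ) ≥ w` (it reaches across `Γ₁(□)` or across `Γ₂(□)`; print's
  exponent `(ϰ/8)b^{3/2} = (ϰ/4)(w/2)` therefore comes out as `(ϰ/4)w`: as printed or better), `hamiltonian_corridorsBar_eq`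
  (`H_{Γ̄₁} = H_{Γ₁} + Σ_m(H_{Γ₂∪Γ₄} + H_{Γ₂,Γ₁}) + remainder`), ★★ `abs_eq534_le` : (5.34)
  `|H_{Γ̄₁}(z) − H_{Γ₁}(z) − Σ_{m∈B}(H_{Γ₂(□)∪Γ₄(□)}(z) + H_{Γ₂(□),Γ₁(□)}(z))| ≤ s₁·A·b^D·e^{−(ϰ/4)w}·|Γ̄₁|`, and `abs_eq534_le'` (`|Γ̄₁| ≤ |B|·L^d`).
* §4 (5.33)'s exponent: ★ `psi1p_add_psi2_eq` — the EXACT identity `Ψ′₁ + Ψ₂ = H_{Γ₂∪Γ₄} + H_{Γ₂,Γ₁} − (H_{Γ₂,Γ₄} − H_{Γ₄,Γ₃})` (print writes the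
  correction as `H_{Γ₄(□),Γ₂(□)∖Γ₃(□)}`; the two differ by the tuples meeting `Γ₄`, `Γ₃` AND `Γ₂∖Γ₃`, which obey the same bound), `crossT_frame4_frame3_subset`,
  `correction_eq_sum`, ★ `le_connLength_of_mem_correctionClass` (`d(Δ) ≥ v` across `Γ₃(□)`), ★★ `abs_correction_le` :
  `|H_{Γ₂,Γ₄} − H_{Γ₄,Γ₃}| ≤ s₁·A·b^D·e^{−(ϰ/4)v}·|□′∪Γ₂(□)|`, ★ `abs_interaction_frame4_frame2_sdiff_frame3_le` — print's literal term
  `|H_{Γ₄(□),Γ₂(□)∖Γ₃(□)}| ≤ s₁·A·b^D·e^{−(ϰ/4)v}·L^d` (print `v = ½b^{3/2}`, `L = b²` ⇒ `s₁Ab^{D+2d}e^{−(ϰ/8)b^{3/2}}`), and the assembled form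
  (5.35) consumes: ★★ `abs_hamiltonian_corridorsBar_sub_sum_psi_le` :
  `|H_{Γ̄₁} − H_{Γ₁} − Σ_{m∈B}(Ψ′₁(□) + Ψ₂(□))| ≤ s₁·A·b^D·(e^{−(ϰ/4)w}·|Γ̄₁| + e^{−(ϰ/4)v}·|B|·L^d)`.
* §5 (5.15) i) «|Ψ_□χ^□_b| ≦ s₂Ab^{D+2d}» — the `ρ = 0` case of the engine: ★ `abs_hamiltonian_le` (`|H_R(z)| ≤ s₁·A·b^D·|R|`), ★★ `abs_psiBox_le`
  (`|Ψ_□(z)| ≤ 2s₁·A·b^D·L^d`, i.e. `s₂ = 2s₁`) — item 1 of the assembly census `pub-ymgap-dag-n08-b/N08-BCG-ASSEMBLY-MAP.md` v1.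
HONEST SCOPE.  Structural Hamiltonian bookkeeping + decay only: the MEASURE side of (5.33)/(5.35) («cumulant formula backwards», «use the Markov
property» = `…Disintegration`/`…Sect5Boxes.integral_P0_prod_boxes_eq`, already in the tree) and the collection of the errors over the `d + 1`
displaced pavements are NOT here; print's `Σ_{□∈Q^b}` over the whole pavement is the finite `Σ_{m∈B}` (extension convention).  count-neutral for
N08; `BasicLemmaPrinted` NOT discharged; nothing about d = 4, the continuum, OS axioms, a mass gap or the Clay problem.
-/

noncomputable section

open Finset
open scoped BigOperators

namespace Literature.MathematicalPhysics.QuantumFieldTheory.Balaban1983to89.B1Eq324BenfattoSect5Eq534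

open Literature.MathematicalPhysics.QuantumFieldTheory.Balaban1983to89.B1Eq324BenfattoLemma
open Literature.MathematicalPhysics.QuantumFieldTheory.Balaban1983to89.B1Eq324BenfattoConnLength
open Literature.MathematicalPhysics.QuantumFieldTheory.Balaban1983to89.B1Eq324BenfattoSect5Boxes
open Literature.MathematicalPhysics.QuantumFieldTheory.Balaban1983to89.B1Eq324BenfattoSect5Eq511
open Literature.MathematicalPhysics.QuantumFieldTheory.Balaban1983to89.B1Eq324BenfattoSect5Eq524

variable {d : ℕ}

/-! ## §1  The generic engine: a separated, anchored tuple class has an exponentially small, extensive sum -/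

section Engine

variable {s D : ℕ} {κ : ℝ} {a : Coef d} {J : Finset (B1Eq324BenfattoLemma.Site d)}

/-- `s₁ ≥ 0`. [cite: BenfattoEtAl1978, (5.11) p.155] -/
theorem s1Const_nonneg (hκ : 0 < κ) (s D d : ℕ) : 0 ≤ s1Const s D d κ := by
  refine Finset.sum_nonneg fun p _ => mul_nonneg (Nat.cast_nonneg _) (pow_nonneg (pow_nonneg (mul_nonneg (div_nonneg (by norm_num) ?_)
    (Real.exp_pos _).le) d) _)
  rw [sub_nonneg]
  exact Real.exp_le_one_iff.mpr (by
    have : 0 ≤ κ / 4 / (p : ℝ) / Real.sqrt d := by positivity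
    linarith)

/-- **THE GENERIC ENGINE behind (5.11), (5.24), (5.34)** (the common mechanism, factored once): let `cls p ⊆ (Fin p → J)` be tuple
classes such that every member has connecting length `d(Δ) ≥ ρ` and all its tesserae in the region `R`.  Then, with `|A^{n}_{Δ}| ≤ A` on
the range of (4.5) and `|z_Δ| ≤ b` on `J` (`b ≥ 1`),
`|Σ_{p=1}^{s} Σ_{Δ∈cls p} Σ_{n admissible} A^{n}_{Δ} e^{−(ϰ/2)d(Δ)} Π_i z_{Δ_i}^{n_i}| ≤ s₁·A·b^D·e^{−(ϰ/4)ρ}·|R|`: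
each term is `≤ A·b^D·e^{−(ϰ/2)d(Δ)}` (`abs_term_le`), `e^{−(ϰ/2)d} ≤ e^{−(ϰ/4)ρ}·e^{−(ϰ/4)d}`, and `Σ_Δ e^{−(ϰ/4)d(Δ)}` anchored at the first
tessera in `R` is `≤ |R|·K^{p−1}` (`Sect5Eq524.sum_exp_anchored_le`). [cite: BenfattoEtAl1978, (5.11) p.155, (5.24) p.157, (5.34) p.159] -/
theorem abs_classSum_le (hκ : 0 < κ) {A : ℝ} (hA0 : 0 ≤ A)
    (hA : ∀ p ∈ Finset.Icc 1 s, ∀ (Δ : Fin p → B1Eq324BenfattoLemma.Site d), (∀ i, Δ i ∈ J) →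
      ∀ n ∈ admissible p D, |a p Δ n| ≤ A)
    {z : B1Eq324BenfattoLemma.Site d → ℝ} {b : ℝ} (hb : 1 ≤ b) (hz : ∀ x ∈ J, |z x| ≤ b)
    (cls : (p : ℕ) → Finset (Fin p → J)) (R : Finset (B1Eq324BenfattoLemma.Site d)) {ρ : ℝ}
    (hsep : ∀ p ∈ Finset.Icc 1 s, ∀ Δ ∈ cls p, ρ ≤ connLength fun i => (Δ i : B1Eq324BenfattoLemma.Site d))
    (hin : ∀ p ∈ Finset.Icc 1 s, ∀ Δ ∈ cls p, ∀ i, ((Δ i : J) : B1Eq324BenfattoLemma.Site d) ∈ R) :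
    |∑ p ∈ Finset.Icc 1 s, ∑ Δ ∈ cls p, ∑ n ∈ admissible p D, term κ a z p Δ n| ≤
      s1Const s D d κ * A * b ^ D * Real.exp (-(κ / 4 * ρ)) * R.card := by
  classical
  -- per tuple: the bound with the split exponential
  have hterm : ∀ p ∈ Finset.Icc 1 s, ∀ Δ ∈ cls p, ∀ n ∈ admissible p D,
      |term κ a z p Δ n| ≤ A * b ^ D * Real.exp (-(κ / 4 * ρ)) *
        Real.exp (-(κ / 4 * connLength fun i => (Δ i : B1Eq324BenfattoLemma.Site d))) := by
    intro p hp Δ hΔ n hn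
    have h1 := abs_term_le (κ := κ) (D := D) (fun i => (Δ i : B1Eq324BenfattoLemma.Site d)) n z
      (hA p hp _ (fun i => (Δ i).2) n hn) hb (fun i => hz _ (Δ i).2) (mem_admissible.mp hn).2
    have hd := hsep p hp Δ hΔ
    have hsplit : Real.exp (-(κ / 2) * connLength fun i => (Δ i : B1Eq324BenfattoLemma.Site d)) ≤
        Real.exp (-(κ / 4 * ρ)) * Real.exp (-(κ / 4 * connLength fun i => (Δ i : B1Eq324BenfattoLemma.Site d))) := by
      rw [← Real.exp_add, Real.exp_le_exp]
      nlinarith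
    calc |term κ a z p Δ n| ≤ A * Real.exp (-(κ / 2) * connLength fun i => (Δ i : B1Eq324BenfattoLemma.Site d)) * b ^ D := h1
      _ ≤ A * (Real.exp (-(κ / 4 * ρ)) * Real.exp (-(κ / 4 * connLength fun i => (Δ i : B1Eq324BenfattoLemma.Site d)))) * b ^ D :=
          mul_le_mul_of_nonneg_right (mul_le_mul_of_nonneg_left hsplit hA0) (pow_nonneg (by linarith) D)
      _ = _ := by ring
  -- per degree: the anchored count
  have hcount : ∀ p ∈ Finset.Icc 1 s,
      ∑ Δ ∈ cls p, Real.exp (-(κ / 4 * connLength fun i => (Δ i : B1Eq324BenfattoLemma.Site d))) ≤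
        R.card * decayConst κ p d ^ (p - 1) := by
    intro p hp
    have hp1 : 0 < p := (Finset.mem_Icc.mp hp).1
    obtain ⟨p', rfl⟩ := Nat.exists_eq_succ_of_ne_zero hp1.ne'
    have hanch := sum_exp_anchored_le (J := J) (d := d) (c := κ / 4) (by positivity) p' R
    have hsub : cls (p' + 1) ⊆ (Finset.univ : Finset (Fin (p' + 1) → J)).filter
        (fun Δ => ((Δ 0 : J) : B1Eq324BenfattoLemma.Site d) ∈ R) := fun Δ hΔ =>
      Finset.mem_filter.mpr ⟨Finset.mem_univ _, hin _ hp Δ hΔ 0⟩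
    calc _ ≤ ∑ Δ ∈ (Finset.univ : Finset (Fin (p' + 1) → J)).filter
            (fun Δ => ((Δ 0 : J) : B1Eq324BenfattoLemma.Site d) ∈ R),
            Real.exp (-(κ / 4 * connLength fun i => (Δ i : B1Eq324BenfattoLemma.Site d))) :=
          Finset.sum_le_sum_of_subset_of_nonneg hsub fun Δ _ _ => (Real.exp_pos _).le
      _ ≤ _ := hanch
      _ ≤ R.card * decayConst κ (p' + 1) d ^ (p' + 1 - 1) := by
          simp only [Nat.add_sub_cancel, decayConst]
          refine mul_le_mul_of_nonneg_right ?_ (pow_nonneg (pow_nonneg (mul_nonneg (div_nonneg (by norm_num) ?_)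
            (Real.exp_pos _).le) d) p')
          · exact_mod_cast card_filter_coe_mem_le (J := J) R
          · rw [sub_nonneg]
            exact Real.exp_le_one_iff.mpr (by
              have : 0 ≤ κ / 4 / ((p' + 1 : ℕ) : ℝ) / Real.sqrt d := by positivity
              push_cast at this ⊢
              linarith)
  -- sum it up
  calc |∑ p ∈ Finset.Icc 1 s, ∑ Δ ∈ cls p, ∑ n ∈ admissible p D, term κ a z p Δ n|
      ≤ ∑ p ∈ Finset.Icc 1 s, ∑ Δ ∈ cls p, ∑ n ∈ admissible p D, |term κ a z p Δ n| := by
        refine (Finset.abs_sum_le_sum_abs _ _).trans (Finset.sum_le_sum fun p _ => ?_)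
        refine (Finset.abs_sum_le_sum_abs _ _).trans (Finset.sum_le_sum fun Δ _ => ?_)
        exact Finset.abs_sum_le_sum_abs _ _
    _ ≤ ∑ p ∈ Finset.Icc 1 s, ∑ Δ ∈ cls p, ∑ _n ∈ admissible p D, A * b ^ D * Real.exp (-(κ / 4 * ρ)) *
            Real.exp (-(κ / 4 * connLength fun i => (Δ i : B1Eq324BenfattoLemma.Site d))) :=
        Finset.sum_le_sum fun p hp => Finset.sum_le_sum fun Δ hΔ => Finset.sum_le_sum fun n hn => hterm p hp Δ hΔ n hn
    _ = ∑ p ∈ Finset.Icc 1 s, A * b ^ D * Real.exp (-(κ / 4 * ρ)) * ((admissible p D).card *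
          ∑ Δ ∈ cls p, Real.exp (-(κ / 4 * connLength fun i => (Δ i : B1Eq324BenfattoLemma.Site d)))) := by
        refine Finset.sum_congr rfl fun p _ => ?_
        simp only [Finset.sum_const, nsmul_eq_mul]
        rw [Finset.mul_sum, Finset.mul_sum]
        refine Finset.sum_congr rfl fun Δ _ => ?_
        ring
    _ ≤ ∑ p ∈ Finset.Icc 1 s, A * b ^ D * Real.exp (-(κ / 4 * ρ)) * ((admissible p D).card *
          (R.card * decayConst κ p d ^ (p - 1))) := by
        refine Finset.sum_le_sum fun p hp => ?_
        exact mul_le_mul_of_nonneg_left (mul_le_mul_of_nonneg_left (hcount p hp) (Nat.cast_nonneg _)) (by positivity)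
    _ = s1Const s D d κ * A * b ^ D * Real.exp (-(κ / 4 * ρ)) * R.card := by
        rw [s1Const, Finset.sum_mul, Finset.sum_mul, Finset.sum_mul, Finset.sum_mul]
        refine Finset.sum_congr rfl fun p _ => ?_
        ring

end Engine

/-! ## §2  «as usual [see (5.24)]»: the interaction of two separated regions -/

section Separated

variable {s D : ℕ} {κ : ℝ} {a : Coef d} {J : Finset (B1Eq324BenfattoLemma.Site d)}

/-- **A crossing tuple of two `ρ`-separated regions has `d(Δ) ≥ ρ`**: it has a tessera in `R` and one in `S`, and the connecting path is at
least as long as their cube distance. [cite: BenfattoEtAl1978, (5.24) p.157, (5.34) p.159] -/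
theorem le_connLength_of_mem_crossT_of_sep {p : ℕ} {R S : Finset (B1Eq324BenfattoLemma.Site d)} {ρ : ℝ}
    (hρ : ∀ x ∈ R, ∀ y ∈ S, ρ ≤ cubeDist x y) {Δ : Fin p → J} (hΔ : Δ ∈ crossT J p R S) :
    ρ ≤ connLength fun i => (Δ i : B1Eq324BenfattoLemma.Site d) := by
  rw [mem_crossT] at hΔ
  obtain ⟨hall, hnR, hnS⟩ := hΔ
  push Not at hnR hnS
  obtain ⟨i, hi⟩ := hnR
  obtain ⟨j, hj⟩ := hnS
  have hiS : ((Δ i : J) : B1Eq324BenfattoLemma.Site d) ∈ S := (Finset.mem_union.mp (hall i)).resolve_left hi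
  have hjR : ((Δ j : J) : B1Eq324BenfattoLemma.Site d) ∈ R := (Finset.mem_union.mp (hall j)).resolve_right hj
  exact (hρ _ hjR _ hiS).trans (cubeDist_le_connLength (fun k => (Δ k : B1Eq324BenfattoLemma.Site d)) j i)

/-- **«AS USUAL [see (5.24)]» — THE INTERACTION OF TWO SEPARATED REGIONS IS EXPONENTIALLY SMALL**: for disjoint regions `R`, `S` whose tesserae
are pairwise at cube distance `≥ ρ`, under the extension convention with `|A^{n}_{Δ}| ≤ A` on the range of (4.5), `|z_Δ| ≤ b` on `J`, `b ≥ 1`: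
`|H_{R,S}(z)| ≤ s₁·A·b^D·e^{−(ϰ/4)ρ}·|R ∪ S|` — the form of every corridor-crossing estimate of pp. 155–159 ((5.11), (5.24), «We now bound
H_{Γ₄(□),Γ₂(□)∖Γ₃(□)} as usual», (5.34)). [cite: BenfattoEtAl1978, (5.24) p.157, (5.34) p.159] -/
theorem abs_interaction_le_of_sep (hκ : 0 < κ) (hJ : CoefSupportedIn a J) {A : ℝ} (hA0 : 0 ≤ A)
    (hA : ∀ p ∈ Finset.Icc 1 s, ∀ (Δ : Fin p → B1Eq324BenfattoLemma.Site d), (∀ i, Δ i ∈ J) →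
      ∀ n ∈ admissible p D, |a p Δ n| ≤ A)
    {R S : Finset (B1Eq324BenfattoLemma.Site d)} (hRS : Disjoint R S) {ρ : ℝ} (hρ : ∀ x ∈ R, ∀ y ∈ S, ρ ≤ cubeDist x y)
    {z : B1Eq324BenfattoLemma.Site d → ℝ} {b : ℝ} (hb : 1 ≤ b) (hz : ∀ x ∈ J, |z x| ≤ b) :
    |interaction s D κ a R S z| ≤ s1Const s D d κ * A * b ^ D * Real.exp (-(κ / 4 * ρ)) * (R ∪ S).card := by
  rw [interaction_eq_sum_crossT hJ hRS]
  exact abs_classSum_le hκ hA0 hA hb hz (fun p => crossT J p R S) (R ∪ S)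
    (fun p _ Δ hΔ => le_connLength_of_mem_crossT_of_sep hρ hΔ) (fun p _ Δ hΔ i => (mem_crossT.mp hΔ).1 i)

end Separated

/-! ## §3  (5.34): `Γ̄₁`, the three accounted tuple classes, the remainder reaches across a corridor, and the bound -/

section Eq534Defs

/-- **Γ̄₁ of (5.34)** — *"Γ̄₁ = ⋃_{□∈Q^b}[Γ₁(□)∪Γ₂(□)∪Γ₄(□)]"*, over the finite family `B` of tesserae:
`Γ₁ ∪ ⋃_{m∈B}(Γ₂(□_m) ∪ Γ₄(□_m))`. [cite: BenfattoEtAl1978, (5.34) p.159] -/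
def corridorsBar (L w v : ℕ) (B : Finset (B1Eq324BenfattoLemma.Site d)) : Finset (B1Eq324BenfattoLemma.Site d) :=
  corridors L w B ∪ B.biUnion fun m => frame2 L w m ∪ frame4 L w v m

/-- **The tuples accounted for by the left side of (5.34)**: inside `Γ₁` (`H_{Γ₁}`), or inside some `Γ₂(□)∪Γ₄(□)` (`H_{Γ₂(□)∪Γ₄(□)}`), or
crossing between `Γ₂(□)` and `Γ₁(□)` (`H_{Γ₂(□),Γ₁(□)}`, the class `Sect5Eq511.crossTuples`). [cite: BenfattoEtAl1978, (5.34) p.159] -/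
def hatTuplesBar (J : Finset (B1Eq324BenfattoLemma.Site d)) (p L w v : ℕ) (B : Finset (B1Eq324BenfattoLemma.Site d)) :
    Finset (Fin p → J) :=
  tuplesIn J p (corridors L w B) ∪ B.biUnion fun m => tuplesIn J p (frame2 L w m ∪ frame4 L w v m) ∪ crossTuples J p L w m

end Eq534Defs

section Eq534Geometry

variable {J : Finset (B1Eq324BenfattoLemma.Site d)} {p L w v : ℕ} {B : Finset (B1Eq324BenfattoLemma.Site d)}
  {m : B1Eq324BenfattoLemma.Site d}

/-- `Γ₂(□) ∪ Γ₄(□) ⊆ □′ ∪ Γ₂(□) = shrink w`. [cite: BenfattoEtAl1978, (5.7) p.154, (5.27) p.157] -/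
theorem frame2_union_frame4_subset_shrink (L w v : ℕ) (m : B1Eq324BenfattoLemma.Site d) :
    frame2 L w m ∪ frame4 L w v m ⊆ shrink L m w :=
  Finset.union_subset (by rw [frame2]; exact Finset.sdiff_subset)
    ((frame4_subset_core L w v m).trans (by rw [core]; exact shrink_mono L m (Nat.le_mul_of_pos_left w two_pos)))

/-- `Γ₂(□) ∪ Γ₄(□) ⊆ □`. [cite: BenfattoEtAl1978, (5.7) p.154] -/
theorem frame2_union_frame4_subset_box (L w v : ℕ) (m : B1Eq324BenfattoLemma.Site d) :
    frame2 L w m ∪ frame4 L w v m ⊆ box L m :=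
  (frame2_union_frame4_subset_shrink L w v m).trans (shrink_subset_box L m w)

/-- `Γ₁ ⊆ Γ̄₁`. [cite: BenfattoEtAl1978, (5.34) p.159] -/
theorem corridors_subset_corridorsBar (L w v : ℕ) (B : Finset (B1Eq324BenfattoLemma.Site d)) :
    corridors L w B ⊆ corridorsBar L w v B :=
  Finset.subset_union_left

/-- `Γ₂(□) ∪ Γ₄(□) ⊆ Γ̄₁` for `□ ∈ B`. [cite: BenfattoEtAl1978, (5.34) p.159] -/
theorem frame2_union_frame4_subset_corridorsBar (L w v : ℕ) (hm : m ∈ B) :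
    frame2 L w m ∪ frame4 L w v m ⊆ corridorsBar L w v B :=
  (Finset.subset_biUnion_of_mem (fun m => frame2 L w m ∪ frame4 L w v m) hm).trans Finset.subset_union_right

/-- `Γ̄₁ ⊆ ⋃_{m∈B} □_m`. [cite: BenfattoEtAl1978, (5.34) p.159] -/
theorem corridorsBar_subset_biUnion_box (L w v : ℕ) (B : Finset (B1Eq324BenfattoLemma.Site d)) :
    corridorsBar L w v B ⊆ B.biUnion fun m => box L m := by
  rw [corridorsBar, corridors]
  refine Finset.union_subset (Finset.biUnion_subset_biUnion_of_subset_left _ le_rfl |>.trans ?_) ?_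
  · exact Finset.biUnion_mono fun m _ => by rw [frame1]; exact Finset.sdiff_subset
  · exact Finset.biUnion_mono fun m _ => frame2_union_frame4_subset_box L w v m

/-- **A site of `Γ̄₁` inside the tessera `□_m`, `m ∈ B`, lies in `Γ₁(□_m)` or in `Γ₂(□_m) ∪ Γ₄(□_m)`** (tesserae are disjoint, `L ≥ 1`).
[cite: BenfattoEtAl1978, (5.34) p.159] -/
theorem mem_corridorsBar_box (hL : 0 < L) {y : B1Eq324BenfattoLemma.Site d} (hy : y ∈ corridorsBar L w v B) (hyb : y ∈ box L m) :
    y ∈ frame1 L w m ∨ y ∈ frame2 L w m ∪ frame4 L w v m := by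
  rw [corridorsBar, Finset.mem_union, corridors, Finset.mem_biUnion, Finset.mem_biUnion] at hy
  rcases hy with ⟨m', -, hy1⟩ | ⟨m', -, hy24⟩
  · have hyb' : y ∈ box L m' := by
      rw [frame1] at hy1
      exact Finset.sdiff_subset hy1
    have hmm : m' = m := (boxIndex_eq_of_mem_box hL hyb').symm.trans (boxIndex_eq_of_mem_box hL hyb)
    subst hmm
    exact Or.inl hy1
  · have hyb' : y ∈ box L m' := frame2_union_frame4_subset_box L w v m' hy24
    have hmm : m' = m := (boxIndex_eq_of_mem_box hL hyb').symm.trans (boxIndex_eq_of_mem_box hL hyb)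
    subst hmm
    exact Or.inr hy24

/-- A site of `Γ̄₁ ∖ Γ₁` lies in `Γ₂(□_m) ∪ Γ₄(□_m)` for some `m ∈ B`. [cite: BenfattoEtAl1978, (5.34) p.159] -/
theorem exists_mem_frame24_of_mem_corridorsBar {y : B1Eq324BenfattoLemma.Site d} (hy : y ∈ corridorsBar L w v B)
    (hy1 : y ∉ corridors L w B) : ∃ m ∈ B, y ∈ frame2 L w m ∪ frame4 L w v m := by
  rw [corridorsBar, Finset.mem_union] at hy
  rcases hy with h | h
  · exact absurd h hy1
  · simpa only [Finset.mem_biUnion] using h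

/-- `Γ₁`-tuples are disjoint from the box classes of (5.34). [cite: BenfattoEtAl1978, (5.34) p.159] -/
theorem disjoint_corridorTuples_boxClassBar (hL : 0 < L) (hp : 0 < p) (m : B1Eq324BenfattoLemma.Site d) :
    Disjoint (tuplesIn J p (corridors L w B)) (tuplesIn J p (frame2 L w m ∪ frame4 L w v m) ∪ crossTuples J p L w m) :=
  (disjoint_corridorTuples_boxClass (J := J) (B := B) (w := w) hL hp m).mono_right
    (Finset.union_subset_union (tuplesIn_mono (frame2_union_frame4_subset_shrink L w v m)) le_rfl)

/-- The box classes of (5.34) of distinct tesserae are disjoint. [cite: BenfattoEtAl1978, (5.34) p.159] -/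
theorem pairwiseDisjoint_boxClassBar (hL : 0 < L) (hp : 0 < p) :
    (B : Set (B1Eq324BenfattoLemma.Site d)).PairwiseDisjoint fun m =>
      tuplesIn J p (frame2 L w m ∪ frame4 L w v m) ∪ crossTuples J p L w m := by
  intro m _ m' _ hne
  have hsub : ∀ m₀ : B1Eq324BenfattoLemma.Site d,
      tuplesIn J p (frame2 L w m₀ ∪ frame4 L w v m₀) ∪ crossTuples J p L w m₀ ⊆ tuplesIn J p (box L m₀) := fun m₀ =>
    Finset.union_subset (tuplesIn_mono (frame2_union_frame4_subset_box L w v m₀)) (crossTuples_subset m₀)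
  exact Finset.disjoint_of_subset_left (hsub m)
    (Finset.disjoint_of_subset_right (hsub m') (disjoint_tuplesIn (disjoint_box hL hne) hp))

/-- Inside one tessera, the `Γ₂(□)∪Γ₄(□)` class and the crossing class are disjoint. [cite: BenfattoEtAl1978, (5.34) p.159] -/
theorem disjoint_frame24Tuples_crossTuples (m : B1Eq324BenfattoLemma.Site d) :
    Disjoint (tuplesIn J p (frame2 L w m ∪ frame4 L w v m)) (crossTuples J p L w m) :=
  (disjoint_shrinkTuples_crossTuples (J := J) (p := p) (L := L) (w := w) m).mono_left
    (tuplesIn_mono (frame2_union_frame4_subset_shrink L w v m))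

/-- The accounted classes are `Γ̄₁`-tuples. [cite: BenfattoEtAl1978, (5.34) p.159] -/
theorem hatTuplesBar_subset : hatTuplesBar J p L w v B ⊆ tuplesIn J p (corridorsBar L w v B) := by
  rw [hatTuplesBar]
  refine Finset.union_subset (tuplesIn_mono (corridors_subset_corridorsBar L w v B)) ?_
  refine Finset.biUnion_subset.mpr fun m hm => Finset.union_subset
    (tuplesIn_mono (frame2_union_frame4_subset_corridorsBar L w v hm)) ?_
  refine (Finset.sdiff_subset).trans (tuplesIn_mono (Finset.union_subset ?_ ?_))
  · exact (Finset.subset_union_left.trans (frame2_union_frame4_subset_corridorsBar L w v hm))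
  · exact (frame1_subset_corridors L w hm).trans (corridors_subset_corridorsBar L w v B)

/-- **THE TUPLE IDENTITY BEHIND (5.34)**: for `p ≥ 1`, summing any weight over the `Γ̄₁`-tuples = over the `Γ₁`-class + over the box classes
(inside `Γ₂(□)∪Γ₄(□)`, crossing `Γ₂(□)`/`Γ₁(□)`) + over the REMAINDER `tuplesIn Γ̄₁ ∖ hatTuplesBar`. [cite: BenfattoEtAl1978, (5.34) p.159] -/
theorem sum_tuplesIn_corridorsBar_eq (hL : 0 < L) (hp : 0 < p) (F : (Fin p → J) → ℝ) :
    ∑ Δ ∈ tuplesIn J p (corridorsBar L w v B), F Δ = ∑ Δ ∈ tuplesIn J p (corridors L w B), F Δ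
      + ∑ m ∈ B, (∑ Δ ∈ tuplesIn J p (frame2 L w m ∪ frame4 L w v m), F Δ + ∑ Δ ∈ crossTuples J p L w m, F Δ)
      + ∑ Δ ∈ tuplesIn J p (corridorsBar L w v B) \ hatTuplesBar J p L w v B, F Δ := by
  classical
  have h1 := Finset.sum_sdiff (f := F) (hatTuplesBar_subset (J := J) (p := p) (L := L) (w := w) (v := v) (B := B))
  have h2 : ∑ Δ ∈ hatTuplesBar J p L w v B, F Δ = ∑ Δ ∈ tuplesIn J p (corridors L w B), F Δ
      + ∑ m ∈ B, (∑ Δ ∈ tuplesIn J p (frame2 L w m ∪ frame4 L w v m), F Δ + ∑ Δ ∈ crossTuples J p L w m, F Δ) := by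
    rw [hatTuplesBar, Finset.sum_union, Finset.sum_biUnion (pairwiseDisjoint_boxClassBar hL hp)]
    · congr 1
      refine Finset.sum_congr rfl fun m _ => ?_
      rw [Finset.sum_union (disjoint_frame24Tuples_crossTuples m)]
    · rw [Finset.disjoint_biUnion_right]
      exact fun m _ => disjoint_corridorTuples_boxClassBar hL hp m
  linarith

/-- **EVERY REMAINDER TUPLE OF (5.34) REACHES ACROSS A CORRIDOR: `d(Δ) ≥ w`** (`L ≥ 1`).  Such a tuple lies in `Γ̄₁`, is not inside `Γ₁`, so
has a tessera `x ∈ Γ₂(□)∪Γ₄(□) ⊆ shrink w` of some `□ ∈ B`; it is not inside `Γ₂(□)∪Γ₄(□)`, so has a tessera `y` elsewhere in `Γ̄₁`: either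
outside `□` (distance `≥ w` from `x` across `Γ₁(□)`), or `y ∈ Γ₁(□)` — then if `x ∈ Γ₄(□) ⊆ □′` the distance is `≥ w` across `Γ₂(□)`, and if
`x ∈ Γ₂(□)` the tuple, not being a `Γ₂(□)`/`Γ₁(□)` crossing tuple, has a third tessera outside `Γ₁(□)∪Γ₂(□)`, i.e. outside `□` or in
`Γ₄(□)`, again `≥ w` away.  (Print's `e^{−(ϰ/8)b^{3/2}}` only uses `d ≥ ½b^{3/2}`.) [cite: BenfattoEtAl1978, (5.34) p.159] -/
theorem le_connLength_of_mem_remainderBar (hL : 0 < L) {Δ : Fin p → J}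
    (hΔ : Δ ∈ tuplesIn J p (corridorsBar L w v B) \ hatTuplesBar J p L w v B) :
    (w : ℝ) ≤ connLength fun i => (Δ i : B1Eq324BenfattoLemma.Site d) := by
  classical
  rw [Finset.mem_sdiff, hatTuplesBar, Finset.mem_union, not_or, Finset.mem_biUnion, not_exists, mem_tuplesIn] at hΔ
  obtain ⟨hall, hΓ, hbox⟩ := hΔ
  -- a tessera outside `Γ₁`: it lies in `Γ₂(□) ∪ Γ₄(□)` of some `□ ∈ B`
  rw [mem_tuplesIn] at hΓ
  push Not at hΓ
  obtain ⟨i, hi⟩ := hΓ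
  obtain ⟨m, hmB, hx⟩ := exists_mem_frame24_of_mem_corridorsBar (hall i) hi
  have hxS : ((Δ i : J) : B1Eq324BenfattoLemma.Site d) ∈ shrink L m w := frame2_union_frame4_subset_shrink L w v m hx
  -- the tuple is not in the classes of the box `m`
  have hnot : Δ ∉ tuplesIn J p (frame2 L w m ∪ frame4 L w v m) ∪ crossTuples J p L w m := fun h => hbox m ⟨hmB, h⟩
  rw [Finset.mem_union, not_or, mem_tuplesIn] at hnot
  obtain ⟨h24, hC⟩ := hnot
  push Not at h24
  obtain ⟨j, hj⟩ := h24
  -- case 1: `Δ j` outside the box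
  by_cases hjbox : ((Δ j : J) : B1Eq324BenfattoLemma.Site d) ∈ box L m
  swap
  · exact (le_cubeDist_of_mem_shrink_of_not_mem_box hxS hjbox).trans
      (cubeDist_le_connLength (fun k => (Δ k : B1Eq324BenfattoLemma.Site d)) i j)
  -- `Δ j ∈ Γ₁(□)`
  have hjF1 : ((Δ j : J) : B1Eq324BenfattoLemma.Site d) ∈ frame1 L w m :=
    (mem_corridorsBar_box hL (hall j) hjbox).resolve_right hj
  rcases Finset.mem_union.mp hx with hx2 | hx4
  swap
  · -- `Δ i ∈ Γ₄(□) ⊆ □′`: distance `≥ w` to `Δ j ∈ Γ₁(□)` across `Γ₂(□)`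
    exact (le_cubeDist_of_mem_core_of_mem_frame1 (frame4_subset_core L w v m hx4) hjF1).trans
      (cubeDist_le_connLength (fun k => (Δ k : B1Eq324BenfattoLemma.Site d)) i j)
  -- `Δ i ∈ Γ₂(□)`: case 2: every tessera in `Γ₂(□) ∪ Γ₁(□)` is impossible (crossing tuple), so a third tessera decides
  by_cases hall21 : ∀ k, ((Δ k : J) : B1Eq324BenfattoLemma.Site d) ∈ frame2 L w m ∪ frame1 L w m
  · exfalso
    refine hC (Finset.mem_sdiff.mpr ⟨mem_tuplesIn.mpr hall21, ?_⟩)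
    rw [Finset.mem_union, not_or, mem_tuplesIn, mem_tuplesIn]
    exact ⟨fun h2 => Finset.disjoint_left.mp (disjoint_frame2_frame1 L w m) (h2 j) hjF1,
      fun h1 => Finset.disjoint_left.mp (disjoint_frame2_frame1 L w m) hx2 (h1 i)⟩
  · push Not at hall21
    obtain ⟨k, hk⟩ := hall21
    rw [Finset.mem_union, not_or] at hk
    by_cases hkbox : ((Δ k : J) : B1Eq324BenfattoLemma.Site d) ∈ box L m
    · -- `Δ k ∈ □ ∩ Γ̄₁`, not in `Γ₁(□)`, not in `Γ₂(□)`: so `Δ k ∈ Γ₄(□) ⊆ □′`, distance `≥ w` to `Δ j ∈ Γ₁(□)`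
      have hk4 : ((Δ k : J) : B1Eq324BenfattoLemma.Site d) ∈ frame4 L w v m := by
        rcases mem_corridorsBar_box hL (hall k) hkbox with h1 | h24
        · exact absurd h1 hk.2
        · exact (Finset.mem_union.mp h24).resolve_left hk.1
      exact (le_cubeDist_of_mem_core_of_mem_frame1 (frame4_subset_core L w v m hk4) hjF1).trans
        (cubeDist_le_connLength (fun k => (Δ k : B1Eq324BenfattoLemma.Site d)) k j)
    · exact (le_cubeDist_of_mem_shrink_of_not_mem_box hxS hkbox).trans
        (cubeDist_le_connLength (fun k => (Δ k : B1Eq324BenfattoLemma.Site d)) i k)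

/-- `|Γ̄₁| ≤ |B|·L^d` (print: `L^d = b^{2d}` sites per tessera). [cite: BenfattoEtAl1978, (5.34) p.159] -/
theorem card_corridorsBar_le (L w v : ℕ) (B : Finset (B1Eq324BenfattoLemma.Site d)) :
    (corridorsBar L w v B).card ≤ B.card * L ^ d := by
  calc (corridorsBar L w v B).card ≤ (B.biUnion fun m => box L m).card := Finset.card_le_card (corridorsBar_subset_biUnion_box L w v B)
    _ ≤ ∑ m ∈ B, (box L m).card := Finset.card_biUnion_le
    _ ≤ ∑ _m ∈ B, L ^ d := Finset.sum_le_sum fun m _ => by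
        rw [← shrink_zero]
        exact card_shrink_le L m 0
    _ = B.card * L ^ d := by rw [Finset.sum_const, smul_eq_mul]

end Eq534Geometry

section Eq534Main

variable {s D : ℕ} {κ : ℝ} {a : Coef d} {J : Finset (B1Eq324BenfattoLemma.Site d)} {L w v : ℕ}
  {B : Finset (B1Eq324BenfattoLemma.Site d)}

/-- **`H_{Γ̄₁}` DECOMPOSED ALONG (5.34)**: `H_{Γ̄₁} = H_{Γ₁} + Σ_{m∈B}(H_{Γ₂(□)∪Γ₄(□)} + H_{Γ₂(□),Γ₁(□)}) + (remainder sum)` (`L ≥ 1`, extension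
convention). [cite: BenfattoEtAl1978, (5.34) p.159] -/
theorem hamiltonian_corridorsBar_eq (hJ : CoefSupportedIn a J) (hL : 0 < L) (z : B1Eq324BenfattoLemma.Site d → ℝ) :
    hamiltonian s D κ a (corridorsBar L w v B) z = hamiltonian s D κ a (corridors L w B) z
      + ∑ m ∈ B, (hamiltonian s D κ a (frame2 L w m ∪ frame4 L w v m) z + interaction s D κ a (frame2 L w m) (frame1 L w m) z)
      + ∑ p ∈ Finset.Icc 1 s, ∑ Δ ∈ tuplesIn J p (corridorsBar L w v B) \ hatTuplesBar J p L w v B,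
          ∑ n ∈ admissible p D, term κ a z p Δ n := by
  classical
  simp only [interaction, hamiltonian_eq_sum_tuplesIn hJ]
  have hbox : ∀ m ∈ B, (∑ p ∈ Finset.Icc 1 s, ∑ Δ ∈ tuplesIn J p (frame2 L w m ∪ frame4 L w v m), ∑ n ∈ admissible p D, term κ a z p Δ n
      + (∑ p ∈ Finset.Icc 1 s, ∑ Δ ∈ tuplesIn J p (frame2 L w m ∪ frame1 L w m), ∑ n ∈ admissible p D, term κ a z p Δ n
        - ∑ p ∈ Finset.Icc 1 s, ∑ Δ ∈ tuplesIn J p (frame2 L w m), ∑ n ∈ admissible p D, term κ a z p Δ n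
        - ∑ p ∈ Finset.Icc 1 s, ∑ Δ ∈ tuplesIn J p (frame1 L w m), ∑ n ∈ admissible p D, term κ a z p Δ n))
      = ∑ p ∈ Finset.Icc 1 s, (∑ Δ ∈ tuplesIn J p (frame2 L w m ∪ frame4 L w v m), ∑ n ∈ admissible p D, term κ a z p Δ n
        + ∑ Δ ∈ crossTuples J p L w m, ∑ n ∈ admissible p D, term κ a z p Δ n) := by
    intro m _
    rw [← Finset.sum_sub_distrib, ← Finset.sum_sub_distrib, ← Finset.sum_add_distrib]
    refine Finset.sum_congr rfl fun p hp => ?_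
    have hp1 : 0 < p := (Finset.mem_Icc.mp hp).1
    rw [sum_crossTuples hp1 m]
  rw [Finset.sum_congr rfl hbox, Finset.sum_comm, ← Finset.sum_add_distrib, ← Finset.sum_add_distrib]
  refine Finset.sum_congr rfl fun p hp => ?_
  have hp1 : 0 < p := (Finset.mem_Icc.mp hp).1
  exact sum_tuplesIn_corridorsBar_eq hL hp1 _

/-- **(5.34) — THE CORRIDOR HAMILTONIANS RE-ASSEMBLE INTO `H_{Γ̄₁}` UP TO AN EXPONENTIALLY SMALL, EXTENSIVE ERROR**: p. 159, *"if Γ̄₁ =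
⋃_{□∈Q^b}[Γ₁(□)∪Γ₂(□)∪Γ₄(□)]  H_{Γ₁} + Σ_{□∈Q^b}(H_{Γ₂(□)∪Γ₄(□)} + H_{Γ₂(□),Γ₁(□)}) = H_{Γ̄₁} + τ|I|(s₁Ab^De^{−(ϰ/8)b^{3/2}}) (5.34)"*, `τ ∈ [−1, 1]`.
PROVED for the tree's objects: under the extension convention `CoefSupportedIn a J`, with `|A^{n}_{Δ}| ≤ A` on the range of (4.5), on
configurations with `|z_Δ| ≤ b` for `Δ ⊂ J`, `b ≥ 1`, tesserae of side `L ≥ 1`, corridors `Γ₁(□)`, `Γ₂(□)` of width `w` and `Γ₄(□)` of width `v`: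
`|H_{Γ̄₁}(z) − H_{Γ₁}(z) − Σ_{m∈B}(H_{Γ₂(□)∪Γ₄(□)}(z) + H_{Γ₂(□),Γ₁(□)}(z))| ≤ s₁·A·b^D·e^{−(ϰ/4)w}·|Γ̄₁|` (print: `w = b^{3/2}`, `|Γ̄₁| ≤ |I|`; the
exponent `(ϰ/4)w` is print's `(ϰ/8)b^{3/2}` or better).  The difference is the sum over the remainder tuples (`hamiltonian_corridorsBar_eq`), each
with `d(Δ) ≥ w` (`le_connLength_of_mem_remainderBar`), all tesserae in `Γ̄₁`; the engine `abs_classSum_le` concludes.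
[cite: BenfattoEtAl1978, (5.34) p.159] -/
theorem abs_eq534_le (hκ : 0 < κ) (hJ : CoefSupportedIn a J) {A : ℝ} (hA0 : 0 ≤ A)
    (hA : ∀ p ∈ Finset.Icc 1 s, ∀ (Δ : Fin p → B1Eq324BenfattoLemma.Site d), (∀ i, Δ i ∈ J) →
      ∀ n ∈ admissible p D, |a p Δ n| ≤ A)
    (hL : 0 < L) {z : B1Eq324BenfattoLemma.Site d → ℝ} {b : ℝ} (hb : 1 ≤ b) (hz : ∀ x ∈ J, |z x| ≤ b) :
    |hamiltonian s D κ a (corridorsBar L w v B) z - hamiltonian s D κ a (corridors L w B) z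
      - ∑ m ∈ B, (hamiltonian s D κ a (frame2 L w m ∪ frame4 L w v m) z + interaction s D κ a (frame2 L w m) (frame1 L w m) z)|
      ≤ s1Const s D d κ * A * b ^ D * Real.exp (-(κ / 4 * w)) * (corridorsBar L w v B).card := by
  rw [hamiltonian_corridorsBar_eq hJ hL z]
  have h3 : ∀ X S R : ℝ, X + S + R - X - S = R := fun X S R => by ring
  rw [h3]
  exact abs_classSum_le hκ hA0 hA hb hz (fun p => tuplesIn J p (corridorsBar L w v B) \ hatTuplesBar J p L w v B)
    (corridorsBar L w v B) (fun p _ Δ hΔ => le_connLength_of_mem_remainderBar hL hΔ)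
    (fun p _ Δ hΔ i => (mem_tuplesIn.mp (Finset.mem_sdiff.mp hΔ).1) i)

/-- **(5.34) with print's volume factor**: `… ≤ s₁·A·b^D·e^{−(ϰ/4)w}·|B|·L^d` (`|B|` tesserae of `L^d = b^{2d}` sites each).
[cite: BenfattoEtAl1978, (5.34) p.159] -/
theorem abs_eq534_le' (hκ : 0 < κ) (hJ : CoefSupportedIn a J) {A : ℝ} (hA0 : 0 ≤ A)
    (hA : ∀ p ∈ Finset.Icc 1 s, ∀ (Δ : Fin p → B1Eq324BenfattoLemma.Site d), (∀ i, Δ i ∈ J) →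
      ∀ n ∈ admissible p D, |a p Δ n| ≤ A)
    (hL : 0 < L) {z : B1Eq324BenfattoLemma.Site d → ℝ} {b : ℝ} (hb : 1 ≤ b) (hz : ∀ x ∈ J, |z x| ≤ b) :
    |hamiltonian s D κ a (corridorsBar L w v B) z - hamiltonian s D κ a (corridors L w B) z
      - ∑ m ∈ B, (hamiltonian s D κ a (frame2 L w m ∪ frame4 L w v m) z + interaction s D κ a (frame2 L w m) (frame1 L w m) z)|
      ≤ s1Const s D d κ * A * b ^ D * Real.exp (-(κ / 4 * w)) * (B.card * (L : ℝ) ^ d) := by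
  refine (abs_eq534_le hκ hJ hA0 hA hL hb hz).trans (mul_le_mul_of_nonneg_left ?_ ?_)
  · exact_mod_cast card_corridorsBar_le L w v B
  · have := s1Const_nonneg hκ s D d
    positivity

end Eq534Main

/-! ## §4  (5.33)'s exponent: `Ψ′₁ + Ψ₂ = H_{Γ₂∪Γ₄} + H_{Γ₂,Γ₁} − (correction across Γ₃(□))`, and «bound H_{Γ₄(□),Γ₂(□)∖Γ₃(□)} as usual» -/

section Eq533

variable {s D : ℕ} {κ : ℝ} {a : Coef d} {J : Finset (B1Eq324BenfattoLemma.Site d)} {L w v : ℕ}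
  {m : B1Eq324BenfattoLemma.Site d} {B : Finset (B1Eq324BenfattoLemma.Site d)}

/-- `Γ₄(□) ∩ Γ₂(□) = ∅`. [cite: BenfattoEtAl1978, (5.27) p.157] -/
theorem disjoint_frame4_frame2 (L w v : ℕ) (m : B1Eq324BenfattoLemma.Site d) : Disjoint (frame4 L w v m) (frame2 L w m) :=
  Finset.disjoint_of_subset_left (frame4_subset_core L w v m) (disjoint_core_frame2 L w m)

/-- `Γ₄(□) ∩ Γ₃(□) = ∅`. [cite: BenfattoEtAl1978, (5.27) p.157] -/
theorem disjoint_frame4_frame3 (L w v : ℕ) (m : B1Eq324BenfattoLemma.Site d) : Disjoint (frame4 L w v m) (frame3 L w v m) :=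
  Finset.disjoint_of_subset_left (frame4_subset_core L w v m) (disjoint_core_frame3 L w v m)

/-- **The exponent of (5.33), EXACTLY**: `Ψ′₁ + Ψ₂ = H_{Γ₂(□)∪Γ₄(□)} + H_{Γ₂(□),Γ₁(□)} − (H_{Γ₄(□),Γ₂(□)} − H_{Γ₄(□),Γ₃(□)})` (pure algebra from
(5.6), (5.23), (5.27)).  Print writes the correction as `H_{Γ₄(□),Γ₂(□)∖Γ₃(□)}`; the exact correction `H_{Γ₄,Γ₂} − H_{Γ₄,Γ₃}` contains in addition
the tuples meeting `Γ₄(□)`, `Γ₃(□)` and `Γ₂(□)∖Γ₃(□)` — all of them reach across `Γ₃(□)`, and both obey the same bound (`abs_correction_le`,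
`abs_interaction_frame4_frame2_sdiff_frame3_le`). [cite: BenfattoEtAl1978, (5.33) p.159] -/
theorem psi1p_add_psi2_eq (s D : ℕ) (κ : ℝ) (a : Coef d) (L w v : ℕ) (m : B1Eq324BenfattoLemma.Site d)
    (z : B1Eq324BenfattoLemma.Site d → ℝ) :
    psi1p s D κ a L w v m z + psi2 s D κ a L w m z =
      hamiltonian s D κ a (frame2 L w m ∪ frame4 L w v m) z + interaction s D κ a (frame2 L w m) (frame1 L w m) z
        - (interaction s D κ a (frame4 L w v m) (frame2 L w m) z - interaction s D κ a (frame4 L w v m) (frame3 L w v m) z) := by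
  simp only [psi1p, psi2, interaction, Finset.union_comm (frame1 L w m) (frame2 L w m),
    Finset.union_comm (frame4 L w v m) (frame2 L w m)]
  ring

/-- The `Γ₄`/`Γ₃` crossing tuples are `Γ₄`/`Γ₂` crossing tuples (`v ≤ w`). [cite: BenfattoEtAl1978, (5.33) p.159] -/
theorem crossT_frame4_frame3_subset {p : ℕ} (hv : v ≤ w) :
    crossT J p (frame4 L w v m) (frame3 L w v m) ⊆ crossT J p (frame4 L w v m) (frame2 L w m) := by
  intro Δ hΔ
  rw [mem_crossT] at hΔ ⊢
  obtain ⟨hall, hn4, hn3⟩ := hΔ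
  refine ⟨fun i => ?_, hn4, fun h2 => ?_⟩
  · rcases Finset.mem_union.mp (hall i) with h | h
    · exact Finset.mem_union_left _ h
    · exact Finset.mem_union_right _ (frame3_subset_frame2 L hv m h)
  · -- all in Γ₂: then none in Γ₄, so all in Γ₃ — contradiction
    refine hn3 fun i => ?_
    rcases Finset.mem_union.mp (hall i) with h | h
    · exact absurd h (Finset.disjoint_right.mp (disjoint_frame4_frame2 L w v m) (h2 i))
    · exact h

/-- **The correction of (5.33) in tuple form**: `H_{Γ₄,Γ₂} − H_{Γ₄,Γ₃}` is the sum over the `Γ₄`/`Γ₂` crossing tuples that are not `Γ₄`/`Γ₃`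
crossing tuples (`v ≤ w`). [cite: BenfattoEtAl1978, (5.33) p.159] -/
theorem correction_eq_sum (hJ : CoefSupportedIn a J) (hv : v ≤ w) (z : B1Eq324BenfattoLemma.Site d → ℝ) :
    interaction s D κ a (frame4 L w v m) (frame2 L w m) z - interaction s D κ a (frame4 L w v m) (frame3 L w v m) z
      = ∑ p ∈ Finset.Icc 1 s, ∑ Δ ∈ crossT J p (frame4 L w v m) (frame2 L w m) \ crossT J p (frame4 L w v m) (frame3 L w v m),
          ∑ n ∈ admissible p D, term κ a z p Δ n := by
  rw [interaction_eq_sum_crossT hJ (disjoint_frame4_frame2 L w v m), interaction_eq_sum_crossT hJ (disjoint_frame4_frame3 L w v m),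
    ← Finset.sum_sub_distrib]
  refine Finset.sum_congr rfl fun p _ => ?_
  have h := Finset.sum_sdiff (f := fun Δ => ∑ n ∈ admissible p D, term κ a z p Δ n)
    (crossT_frame4_frame3_subset (J := J) (p := p) (L := L) (m := m) hv)
  linarith

/-- A site of `Γ₂(□) ∖ Γ₃(□)` is NOT at depth `≥ 2w − v` (it lies in `shrink w ∖ shrink 2w` and outside `shrink (2w−v) ∖ shrink 2w`).
[cite: BenfattoEtAl1978, (5.23) p.157] -/
theorem not_mem_shrink_of_mem_frame2_of_not_mem_frame3 {y : B1Eq324BenfattoLemma.Site d} (hy2 : y ∈ frame2 L w m)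
    (hy3 : y ∉ frame3 L w v m) : y ∉ shrink L m (2 * w - v) := by
  intro hsh
  rw [frame2, Finset.mem_sdiff] at hy2
  refine hy3 ?_
  rw [frame3, annulus]
  exact Finset.mem_sdiff.mpr ⟨hsh, hy2.2⟩

/-- A site of `Γ₄(□) ⊆ □′ = shrink 2w` is at depth `≥ (2w − v) + v` (`v ≤ 2w`). [cite: BenfattoEtAl1978, (5.27) p.157] -/
theorem mem_shrink_of_mem_frame4 (hv : v ≤ 2 * w) {x : B1Eq324BenfattoLemma.Site d} (hx : x ∈ frame4 L w v m) :
    x ∈ shrink L m (2 * w - v + v) := by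
  rw [Nat.sub_add_cancel hv]
  have h := frame4_subset_core L w v m hx
  rwa [core] at h

/-- **Every tuple of the correction reaches across `Γ₃(□)`: `d(Δ) ≥ v`** (`v ≤ 2w`): it has a tessera in `Γ₄(□)` (depth `≥ 2w`) and one in
`Γ₂(□) ∖ Γ₃(□)` (depth `< 2w − v`). [cite: BenfattoEtAl1978, (5.33) p.159] -/
theorem le_connLength_of_mem_correctionClass {p : ℕ} (hv : v ≤ 2 * w) {Δ : Fin p → J}
    (hΔ : Δ ∈ crossT J p (frame4 L w v m) (frame2 L w m) \ crossT J p (frame4 L w v m) (frame3 L w v m)) :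
    (v : ℝ) ≤ connLength fun i => (Δ i : B1Eq324BenfattoLemma.Site d) := by
  rw [Finset.mem_sdiff, mem_crossT, mem_crossT] at hΔ
  obtain ⟨⟨hall, hn4, hn2⟩, hnot⟩ := hΔ
  -- a tessera in Γ₄
  have h4 : ∃ i, ((Δ i : J) : B1Eq324BenfattoLemma.Site d) ∈ frame4 L w v m := by
    by_contra h
    push Not at h
    exact hn2 fun i => (Finset.mem_union.mp (hall i)).resolve_left (h i)
  obtain ⟨i, hi⟩ := h4
  -- a tessera outside Γ₄ ∪ Γ₃
  have hout : ∃ j, ((Δ j : J) : B1Eq324BenfattoLemma.Site d) ∉ frame4 L w v m ∪ frame3 L w v m := by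
    by_contra h
    push Not at h
    exact hnot ⟨h, hn4, fun h3 => Finset.disjoint_left.mp (disjoint_frame4_frame3 L w v m) hi (h3 i)⟩
  obtain ⟨j, hj⟩ := hout
  rw [Finset.mem_union, not_or] at hj
  have hj2 : ((Δ j : J) : B1Eq324BenfattoLemma.Site d) ∈ frame2 L w m := (Finset.mem_union.mp (hall j)).resolve_left hj.1
  exact (le_cubeDist_of_mem_shrink_of_not_mem_shrink (mem_shrink_of_mem_frame4 hv hi)
    (not_mem_shrink_of_mem_frame2_of_not_mem_frame3 hj2 hj.2)).trans
    (cubeDist_le_connLength (fun k => (Δ k : B1Eq324BenfattoLemma.Site d)) i j)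

/-- **THE CORRECTION OF (5.33) IS EXPONENTIALLY SMALL** («We now bound H_{Γ₄(□),Γ₂(□)∖Γ₃(□)} as usual [see (5.24)]», p. 159; exact form):
`|H_{Γ₄(□),Γ₂(□)}(z) − H_{Γ₄(□),Γ₃(□)}(z)| ≤ s₁·A·b^D·e^{−(ϰ/4)v}·|□′∪Γ₂(□)|` (`v ≤ w`; print `v = ½b^{3/2}`, `|□′∪Γ₂(□)| ≤ b^{2d}` ⇒
`s₁Ab^{D+2d}e^{−(ϰ/8)b^{3/2}}`). [cite: BenfattoEtAl1978, (5.33) p.159] -/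
theorem abs_correction_le (hκ : 0 < κ) (hJ : CoefSupportedIn a J) {A : ℝ} (hA0 : 0 ≤ A)
    (hA : ∀ p ∈ Finset.Icc 1 s, ∀ (Δ : Fin p → B1Eq324BenfattoLemma.Site d), (∀ i, Δ i ∈ J) →
      ∀ n ∈ admissible p D, |a p Δ n| ≤ A)
    (hv : v ≤ w) {z : B1Eq324BenfattoLemma.Site d → ℝ} {b : ℝ} (hb : 1 ≤ b) (hz : ∀ x ∈ J, |z x| ≤ b) :
    |interaction s D κ a (frame4 L w v m) (frame2 L w m) z - interaction s D κ a (frame4 L w v m) (frame3 L w v m) z|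
      ≤ s1Const s D d κ * A * b ^ D * Real.exp (-(κ / 4 * v)) * (shrink L m w).card := by
  rw [correction_eq_sum hJ hv z]
  refine abs_classSum_le hκ hA0 hA hb hz
    (fun p => crossT J p (frame4 L w v m) (frame2 L w m) \ crossT J p (frame4 L w v m) (frame3 L w v m)) (shrink L m w)
    (fun p _ Δ hΔ => le_connLength_of_mem_correctionClass (by omega) hΔ) (fun p _ Δ hΔ i => ?_)
  have h := (mem_crossT.mp (Finset.mem_sdiff.mp hΔ).1).1 i
  rw [Finset.union_comm] at h
  exact frame2_union_frame4_subset_shrink L w v m h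

/-- **Print's literal term, «We now bound H_{Γ₄(□),Γ₂(□)∖Γ₃(□)} as usual [see (5.24)]»** (p. 159): the regions `Γ₄(□)` (depth `≥ 2w`) and
`Γ₂(□)∖Γ₃(□)` (depth `< 2w − v`) are `≥ v` apart across `Γ₃(□)`, so by `abs_interaction_le_of_sep`
`|H_{Γ₄(□),Γ₂(□)∖Γ₃(□)}(z)| ≤ s₁·A·b^D·e^{−(ϰ/4)v}·L^d` (print `v = ½b^{3/2}`, `L^d = b^{2d}` ⇒ `s₁Ab^{D+2d}e^{−(ϰ/8)b^{3/2}}`).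
[cite: BenfattoEtAl1978, (5.33)–(5.34) p.159] -/
theorem abs_interaction_frame4_frame2_sdiff_frame3_le (hκ : 0 < κ) (hJ : CoefSupportedIn a J) {A : ℝ} (hA0 : 0 ≤ A)
    (hA : ∀ p ∈ Finset.Icc 1 s, ∀ (Δ : Fin p → B1Eq324BenfattoLemma.Site d), (∀ i, Δ i ∈ J) →
      ∀ n ∈ admissible p D, |a p Δ n| ≤ A)
    (hv : v ≤ w) {z : B1Eq324BenfattoLemma.Site d → ℝ} {b : ℝ} (hb : 1 ≤ b) (hz : ∀ x ∈ J, |z x| ≤ b) :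
    |interaction s D κ a (frame4 L w v m) (frame2 L w m \ frame3 L w v m) z|
      ≤ s1Const s D d κ * A * b ^ D * Real.exp (-(κ / 4 * v)) * (L : ℝ) ^ d := by
  have hdisj : Disjoint (frame4 L w v m) (frame2 L w m \ frame3 L w v m) :=
    (disjoint_frame4_frame2 L w v m).mono_right Finset.sdiff_subset
  have hsep : ∀ x ∈ frame4 L w v m, ∀ y ∈ frame2 L w m \ frame3 L w v m, (v : ℝ) ≤ cubeDist x y := by
    intro x hx y hy
    rw [Finset.mem_sdiff] at hy
    exact le_cubeDist_of_mem_shrink_of_not_mem_shrink (mem_shrink_of_mem_frame4 (by omega) hx)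
      (not_mem_shrink_of_mem_frame2_of_not_mem_frame3 hy.1 hy.2)
  refine (abs_interaction_le_of_sep hκ hJ hA0 hA hdisj hsep hb hz).trans (mul_le_mul_of_nonneg_left ?_ ?_)
  · have hsub : frame4 L w v m ∪ frame2 L w m \ frame3 L w v m ⊆ box L m :=
      Finset.union_subset ((frame4_subset_core L w v m).trans (shrink_subset_box L m (2 * w)))
        (Finset.sdiff_subset.trans (Finset.subset_union_left.trans (frame2_union_frame4_subset_box L w v m)))
    have hcard : (frame4 L w v m ∪ frame2 L w m \ frame3 L w v m).card ≤ L ^ d :=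
      (Finset.card_le_card hsub).trans (by rw [← shrink_zero]; exact card_shrink_le L m 0)
    exact_mod_cast hcard
  · have := s1Const_nonneg hκ s D d
    positivity

/-- **(5.33)–(5.34) ASSEMBLED, the form (5.35) consumes**: the per-box exponents `Ψ′₁(□) + Ψ₂(□)` of (5.32)/(5.33) and `H_{Γ₁}` re-assemble into
`H_{Γ̄₁}` up to exponentially small extensive errors —
`|H_{Γ̄₁}(z) − H_{Γ₁}(z) − Σ_{m∈B}(Ψ′₁(□_m)(z) + Ψ₂(□_m)(z))| ≤ s₁·A·b^D·(e^{−(ϰ/4)w}·|Γ̄₁| + e^{−(ϰ/4)v}·|B|·L^d)`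
(`L ≥ 1`, `v ≤ w`; print: both errors `τ|I|s₁Ab^{D(+2d)}e^{−(ϰ/8)b^{3/2}}`). [cite: BenfattoEtAl1978, (5.33)–(5.35) p.159] -/
theorem abs_hamiltonian_corridorsBar_sub_sum_psi_le (hκ : 0 < κ) (hJ : CoefSupportedIn a J) {A : ℝ} (hA0 : 0 ≤ A)
    (hA : ∀ p ∈ Finset.Icc 1 s, ∀ (Δ : Fin p → B1Eq324BenfattoLemma.Site d), (∀ i, Δ i ∈ J) →
      ∀ n ∈ admissible p D, |a p Δ n| ≤ A)
    (hL : 0 < L) (hv : v ≤ w) {z : B1Eq324BenfattoLemma.Site d → ℝ} {b : ℝ} (hb : 1 ≤ b) (hz : ∀ x ∈ J, |z x| ≤ b) :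
    |hamiltonian s D κ a (corridorsBar L w v B) z - hamiltonian s D κ a (corridors L w B) z
      - ∑ m ∈ B, (psi1p s D κ a L w v m z + psi2 s D κ a L w m z)|
      ≤ s1Const s D d κ * A * b ^ D *
        (Real.exp (-(κ / 4 * w)) * (corridorsBar L w v B).card + Real.exp (-(κ / 4 * v)) * (B.card * (L : ℝ) ^ d)) := by
  -- the per-box exponents: accounted part minus correction
  set X : B1Eq324BenfattoLemma.Site d → ℝ := fun m =>
    interaction s D κ a (frame4 L w v m) (frame2 L w m) z - interaction s D κ a (frame4 L w v m) (frame3 L w v m) z with hX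
  have hsum : ∑ m ∈ B, (psi1p s D κ a L w v m z + psi2 s D κ a L w m z) =
      ∑ m ∈ B, (hamiltonian s D κ a (frame2 L w m ∪ frame4 L w v m) z + interaction s D κ a (frame2 L w m) (frame1 L w m) z)
        - ∑ m ∈ B, X m := by
    rw [← Finset.sum_sub_distrib]
    exact Finset.sum_congr rfl fun m _ => psi1p_add_psi2_eq s D κ a L w v m z
  rw [hsum]
  have e : ∀ H H1 S T : ℝ, H - H1 - (S - T) = (H - H1 - S) + T := fun _ _ _ _ => by ring
  rw [e]
  have h1 := abs_eq534_le (v := v) (B := B) hκ hJ hA0 hA hL hb hz (w := w) (z := z)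
  have h2 : |∑ m ∈ B, X m| ≤ B.card * (s1Const s D d κ * A * b ^ D * Real.exp (-(κ / 4 * v)) * (L : ℝ) ^ d) := by
    refine (Finset.abs_sum_le_sum_abs _ _).trans ?_
    have hle : ∀ m ∈ B, |X m| ≤ s1Const s D d κ * A * b ^ D * Real.exp (-(κ / 4 * v)) * (L : ℝ) ^ d := by
      intro m _
      refine (abs_correction_le hκ hJ hA0 hA hv hb hz).trans (mul_le_mul_of_nonneg_left ?_ ?_)
      · exact_mod_cast card_shrink_le L m w
      · have := s1Const_nonneg hκ s D d
        positivity
    calc ∑ m ∈ B, |X m| ≤ ∑ _m ∈ B, s1Const s D d κ * A * b ^ D * Real.exp (-(κ / 4 * v)) * (L : ℝ) ^ d :=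
          Finset.sum_le_sum hle
      _ = _ := by rw [Finset.sum_const, nsmul_eq_mul]
  calc _ ≤ |hamiltonian s D κ a (corridorsBar L w v B) z - hamiltonian s D κ a (corridors L w B) z
          - ∑ m ∈ B, (hamiltonian s D κ a (frame2 L w m ∪ frame4 L w v m) z + interaction s D κ a (frame2 L w m) (frame1 L w m) z)|
          + |∑ m ∈ B, X m| := abs_add_le _ _
    _ ≤ s1Const s D d κ * A * b ^ D * Real.exp (-(κ / 4 * w)) * (corridorsBar L w v B).card
          + B.card * (s1Const s D d κ * A * b ^ D * Real.exp (-(κ / 4 * v)) * (L : ℝ) ^ d) := add_le_add h1 h2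
    _ = _ := by ring

end Eq533

/-! ## §5  (5.15) i): the a-priori size `|Ψ_□χ^□_b| ≦ s₂Ab^{D+2d}` — the `ρ = 0` case of the engine -/

section Eq515

variable {s D : ℕ} {κ : ℝ} {a : Coef d} {J : Finset (B1Eq324BenfattoLemma.Site d)} {L w : ℕ}
  {m : B1Eq324BenfattoLemma.Site d}

/-- **The a-priori size of a region Hamiltonian on the small-field set**: `|H_R(z)| ≤ s₁·A·b^D·|R|` (extension convention, `|A^{n}_{Δ}| ≤ A` on
the range of (4.5), `|z_Δ| ≤ b` on `J`, `b ≥ 1`) — the engine `abs_classSum_le` at separation `ρ = 0` (`d(Δ) ≥ 0`), all tesserae in `R`.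
[cite: BenfattoEtAl1978, (5.15) p.155] -/
theorem abs_hamiltonian_le (hκ : 0 < κ) (hJ : CoefSupportedIn a J) {A : ℝ} (hA0 : 0 ≤ A)
    (hA : ∀ p ∈ Finset.Icc 1 s, ∀ (Δ : Fin p → B1Eq324BenfattoLemma.Site d), (∀ i, Δ i ∈ J) →
      ∀ n ∈ admissible p D, |a p Δ n| ≤ A)
    (R : Finset (B1Eq324BenfattoLemma.Site d)) {z : B1Eq324BenfattoLemma.Site d → ℝ} {b : ℝ} (hb : 1 ≤ b) (hz : ∀ x ∈ J, |z x| ≤ b) :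
    |hamiltonian s D κ a R z| ≤ s1Const s D d κ * A * b ^ D * R.card := by
  rw [hamiltonian_eq_sum_tuplesIn hJ]
  have h := abs_classSum_le hκ hA0 hA hb hz (fun p => tuplesIn J p R) R (ρ := 0)
    (fun p _ Δ _ => connLength_nonneg fun i => (Δ i : B1Eq324BenfattoLemma.Site d)) (fun p _ Δ hΔ i => (mem_tuplesIn.mp hΔ) i)
  simpa only [mul_zero, neg_zero, Real.exp_zero, mul_one] using h

/-- **(5.15) i) — `|Ψ_□χ^□_b| ≦ s₂Ab^{D+2d}`**: p. 155, *"i) There is a constant s₂ such that |Ψ_□χ^□_b| ≦ s₂Ab^{D+2d} as it follows from the assumed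
structure of H_J."*  PROVED for the tree's `psiBox = H_{□′∪Γ₂(□)} + H_{Γ₂(□),Γ₁(□)}`: on configurations with `|z_Δ| ≤ b` on `J` (`b ≥ 1`), under
the extension convention with `|A^{n}_{Δ}| ≤ A` on the range of (4.5), `|Ψ_□(z)| ≤ 2·s₁·A·b^D·L^d` — `s₂ = 2s₁`, `L^d = b^{2d}` for print's `L = b²`
(`abs_hamiltonian_le` on `□′∪Γ₂(□) = shrink w` and `abs_interaction_le_of_sep` at `ρ = 0` on `Γ₂(□)`, `Γ₁(□)`, both regions inside `□`).
[cite: BenfattoEtAl1978, (5.15) p.155] -/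
theorem abs_psiBox_le (hκ : 0 < κ) (hJ : CoefSupportedIn a J) {A : ℝ} (hA0 : 0 ≤ A)
    (hA : ∀ p ∈ Finset.Icc 1 s, ∀ (Δ : Fin p → B1Eq324BenfattoLemma.Site d), (∀ i, Δ i ∈ J) →
      ∀ n ∈ admissible p D, |a p Δ n| ≤ A)
    {z : B1Eq324BenfattoLemma.Site d → ℝ} {b : ℝ} (hb : 1 ≤ b) (hz : ∀ x ∈ J, |z x| ≤ b) :
    |psiBox s D κ a L w m z| ≤ 2 * s1Const s D d κ * A * b ^ D * (L : ℝ) ^ d := by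
  have hs : 0 ≤ s1Const s D d κ * A * b ^ D := by
    have := s1Const_nonneg hκ s D d
    positivity
  have h1 : |hamiltonian s D κ a (shrink L m w) z| ≤ s1Const s D d κ * A * b ^ D * (L : ℝ) ^ d :=
    (abs_hamiltonian_le hκ hJ hA0 hA (shrink L m w) hb hz).trans
      (mul_le_mul_of_nonneg_left (by exact_mod_cast card_shrink_le L m w) hs)
  have h2 : |interaction s D κ a (frame2 L w m) (frame1 L w m) z| ≤ s1Const s D d κ * A * b ^ D * (L : ℝ) ^ d := by
    have h := abs_interaction_le_of_sep hκ hJ hA0 hA (disjoint_frame2_frame1 L w m) (ρ := 0)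
      (fun x _ y _ => by unfold cubeDist; positivity) hb hz (s := s) (D := D) (z := z)
    rw [mul_zero, neg_zero, Real.exp_zero, mul_one] at h
    refine h.trans (mul_le_mul_of_nonneg_left ?_ hs)
    have hsub : frame2 L w m ∪ frame1 L w m ⊆ box L m :=
      Finset.union_subset (by rw [frame2]; exact Finset.sdiff_subset.trans (shrink_subset_box L m w))
        (by rw [frame1]; exact Finset.sdiff_subset)
    have hcard : (frame2 L w m ∪ frame1 L w m).card ≤ L ^ d :=
      (Finset.card_le_card hsub).trans (by rw [← shrink_zero]; exact card_shrink_le L m 0)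
    exact_mod_cast hcard
  rw [psiBox]
  calc _ ≤ |hamiltonian s D κ a (shrink L m w) z| + |interaction s D κ a (frame2 L w m) (frame1 L w m) z| := abs_add_le _ _
    _ ≤ _ := by linarith

end Eq515

end Literature.MathematicalPhysics.QuantumFieldTheory.Balaban1983to89.B1Eq324BenfattoSect5Eq534

end
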